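import Literature.NumberTheory.Automorphic.HeckeDoubleCosetOperators
import HarnessLib

/-!
# R90 · S6 «Ch. 14.1–14.5 stable trace formula» — WAVE 8 glue card: a family of double cosets covering `G` with
# pairwise distinct indices makes the index SEPARATE the `K`-double cosets (`Theorems/R90S6OrbitNcardCoverGlue.lean`)

Cell `hodgecm-mathlib`, crux H413 (`stmt-HodgeConjecture-24833`), route of record `HCCMUnconditional`; programme R90-TF,
section S6 (base `R90-C14`), seat R90-C14-p06 (g0); S6 DEAL «WAVE 8 + W7-h + TOKENS» (R90-C14-plan (g2), R90 bus
2026-09-04T23:34:54Z: «land the generic glue `orbit_mem_of_ncard_eq_of_cover_of_injective` FIRST as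
`Theorems/R90S6OrbitNcardCoverGlue.lean`, then W8-c = glue + W8-a ★ + W8-b ★ + strict monotonicity»; RULING (2) 23:38:35Z: W8-c′ =
glue + W8-a ★ + p07's `ncard_orbit_torusGen_pow_injective_inert`).  Helper lane `--supports stmt-HodgeConjecture-24833 --as helper`;
THEOREMS ONLY (no definition, no instance, no notation, no named fact, no `sorry`); imports = ★
`Literature.NumberTheory.Automorphic.HeckeDoubleCosetOperators` + HarnessLib (no Lines import); namespace `…R90.S6`.

CONTENT (pure group theory; the W7∕W8 sheets' currency: index of `K g K` = `(MulAction.orbit K (g : G ⧸ K)).ncard = #(KgK ∕ K)`,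
«`g′K ∈ KgK ∕ K`» = `(g′ : G ⧸ K) ∈ MulAction.orbit K (g : G ⧸ K)`).  Let `t : ι → G` be a family whose double cosets COVER `G`
(`hcover : ∀ g, ∃ i, gK ∈ K · t(i)K` — e.g. the Cartan shells `K₀ tᵐ K₀`, ★ W8-a `exists_mem_orbit_torusGen_pow_three`) and whose indices
are PAIRWISE DISTINCT (`hinj : i ↦ #(K t(i) K ∕ K)` injective — W8-b + strict monotonicity, or p07's
`ncard_orbit_torusGen_pow_injective_inert`).  Then the index separates the `K`-double cosets: `#(KgK ∕ K) = #(Kg′K ∕ K) ⇒ g′K ∈ K · gK`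
— the hypothesis `hsep` of ★ W7-a.3 `mk_mulEquiv_mem_orbit_of_ncard_separates` ∕ ★ W7-a.4 `coeff_toVector_comp_eq_of_memLaw`.
Proof: `gK ∈ K·t(i)K`, `g′K ∈ K·t(j)K` give `K·gK = K·t(i)K`, `K·g′K = K·t(j)K` (`MulAction.orbit_eq_iff`); the indices of `t(i)`, `t(j)`
then agree, so `i = j`, and `g′K ∈ K·t(i)K = K·gK`.  No finiteness guard (an infinite orbit has `ncard 0`; `hinj` is what it is).

* **`orbit_mem_of_ncard_eq_of_cover_of_injective`** — the glue (name dealt 23:34:54Z).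

HONEST LABEL: a helper theorem, count-neutral until the E1.3.9 assembly consumes W8-c∕W8-c′ through W7-a.4; HC_CM is proved only
modulo the 7 printed citations (2 remaining named inputs: hLiu418 = stmt-HodgeConjecture-24832, h413 = stmt-HodgeConjecture-24833) until
rung 0 closes; REL ≠ ★ ≠ BUILT.

## References
* [BruhatTits1972] F. Bruhat, J. Tits, *Groupes réductifs sur un corps local I*, Publ. IHÉS 41 (1972), (4.4.3)–(4.4.4) (Cartan
  decomposition `G = ⊔ K t K`, the shells it is applied to).
* [ShimuraIATAF1971] G. Shimura, *Introduction to the arithmetic theory of automorphic functions* (1971), §3.1 (`deg KgK = #(KgK ∕ K)`).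
-/

set_option autoImplicit false
-- the mandated namespace repeats the single-problem summit's segment (`HodgeConjecture.HodgeConjecture`)
set_option linter.dupNamespace false

noncomputable section

open MulAction
open Literature.NumberTheory.Automorphic

namespace Summit.HodgeConjecture.HodgeConjecture.R90.S6

/-- **Glue** `orbit_mem_of_ncard_eq_of_cover_of_injective`: if the double cosets `K t(i) K` of a family `t : ι → G` cover `G`
(`hcover`) and their indices `#(K t(i) K ∕ K) = (K · t(i)K).ncard` are pairwise distinct (`hinj`), then the index SEPARATES the
`K`-double cosets of `G`: `#(KgK ∕ K) = #(Kg′K ∕ K)` forces `g′K ∈ K · gK` (i.e. `Kg′K = KgK`) — the letter `hsep` of W7-a.3 ∕ W7-a.4.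
[folklore] -/
theorem orbit_mem_of_ncard_eq_of_cover_of_injective {G : Type*} [Group G] (K : Subgroup G) {ι : Type*} (t : ι → G)
    (hcover : ∀ g : G, ∃ i, (g : G ⧸ K) ∈ orbit K (t i : G ⧸ K))
    (hinj : Function.Injective fun i => (orbit K (t i : G ⧸ K)).ncard)
    {g g' : G} (h : (orbit K (g : G ⧸ K)).ncard = (orbit K (g' : G ⧸ K)).ncard) :
    (g' : G ⧸ K) ∈ orbit K (g : G ⧸ K) := by
  obtain ⟨i, hi⟩ := hcover g
  obtain ⟨j, hj⟩ := hcover g'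
  -- `K · gK = K · t(i)K` and `K · g′K = K · t(j)K`
  rw [← MulAction.orbit_eq_iff] at hi hj
  rw [hi, hj] at h
  -- equal indices force `i = j`
  obtain rfl : i = j := hinj h
  rw [← MulAction.orbit_eq_iff, hi, hj]

end Summit.HodgeConjecture.HodgeConjecture.R90.S6

end
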